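import Literature.Analysis.Distribution.Hypoelliptic
import Literature.Analysis.FunctionSpaces.FourierSobolevNorm
import Mathlib.Analysis.InnerProductSpace.EuclideanDist
import Mathlib.Analysis.Normed.Module.FiniteDimension
import HarnessLib

/-!
# Hörmander 1967, §3: the norms `|||·|||`, `|||·|||'`, `‖·‖_(s)` and the a priori estimates (3.4), (3.5) of the proof of Theorem 1.1

Analysis/Distribution support file: the VOCABULARY of the decomposition of the named fact
`Literature.Analysis.Distribution.Hormander1967_thm11` (`Hypoelliptic.lean`; Hörmander's
hypoellipticity theorem for `P = ∑ X_j² + X₀ + c`, serving the provefact unit of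
`Literature.MathematicalPhysics.KineticTheory.HeatConduction.CuneoEckmannHairerReyBellet2018_smoothDensity`)
along the architecture of the printed proof (Acta Math. 119 (1967), §3, pp. 152–156):

* p. 152: for `v ∈ C_0^∞(K)`, `K ⊂ Ω` compact, `|||v|||² = ∑₁ʳ ‖X_j v‖² + ‖v‖²` (`‖·‖` the
  `L²` norm) and the dual norm `|||f|||' = sup |∫ f v dx| / |||v|||`; integrating by parts,
  (3.1)–(3.2), and "(3.3) `|||v|||² + |||X₀v|||'² ≤ C(‖v‖² + |||Pv|||'²)`, `v ∈ C_0^∞(K)`".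
* p. 153: `‖v‖_(s)² = (2π)^{-n} ∫ |v̂(ξ)|² (1 + |ξ|²)^s dξ`; "The main point of this paper is
  the proof given in sections 4 and 5 that for some `ε > 0`
  (3.4) `‖v‖_(ε) ≤ C(|||v||| + |||X₀v|||')`, `v ∈ C_0^∞(K)`, when the hypotheses of Theorem 1.1
  are fulfilled. Combining this with (3.3) we obtain
  (3.5) `‖v‖_(ε) ≤ C(‖v‖ + |||Pv|||')`, `v ∈ C_0^∞(K)`. We shall now prove that it follows from
  (3.5) that `P` is hypoelliptic." (The paper prints the gain of (3.4)/(3.5) with the letter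
  `s` and renames it `ε` in Proposition 3.2, where `s` becomes an arbitrary Sobolev index; we
  write `ε` for the gain throughout.)
* p. 155, Proposition 3.2: "Assume that (3.5) is valid for compact subsets `K` of `Ω`. If
  `u ∈ 𝓓'(Ω)` and `Pu ∈ H^loc_(s)(Ω)`, it follows that `u ∈ H^loc_(s+ε)(Ω)`. The same is true
  for open subsets of `Ω`, so in particular `P` is hypoelliptic."
* p. 159, Theorem 4.3 (hypothesis "`T^s(Ω) = T(Ω)` for some `s > 0`": the `C^∞(Ω)`-module
  generated by finitely many brackets `X_I`, `s(I) ≥ s`, is all of `T(Ω)`) and p. 167,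
  Theorem 5.1: `|u|_{X,s} ≤ C(X)(|||u||| + |||X₀u|||')`, `u ∈ C_0^∞(K)`, `X ∈ T^s(Ω)`;
  "Clearly Theorem 5.1 completes the proof of Theorem 1.1" (i.e. of (3.4), using (4.5) and
  the comparison `‖u‖_(t) ≤ C(|u|_s + ‖u‖)`, `t < s`, of p. 159).

## What is vendored

* `Literature.Analysis.Distribution.l2Norm μ f = (∫ f² dμ)^{1/2}`,
  `Literature.Analysis.Distribution.tripleNorm μ X v = |||v|||`,
  `Literature.Analysis.Distribution.tripleDualNorm μ Ω X f = |||f|||'` (supremum over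
  `w ∈ 𝓓(Ω)`), `Literature.Analysis.Distribution.sobolevNorm s v = ‖v‖_(s)` (the tree's
  Fourier-side `H^s` norm `Function.eSobolevNorm` of
  `Literature/Analysis/FunctionSpaces/FourierSobolevNorm.lean`, applied to `v` read in the
  linear coordinates `toEuclidean`, made real by `toReal`).
* `Literature.Analysis.Distribution.HasSpanningBrackets X s` — the hypothesis of Theorems 4.3/5.1
  in pointwise form: finitely many iterated brackets of the family `X` span the space at
  every point of `s`; `IsBracketGenerating.exists_hasSpanningBrackets_nhds` PROVES that the
  pointwise bracket condition of Theorem 1.1 implies it near every point (lower semicontinuity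
  of the rank).
* The PREDICATES `Literature.Analysis.Distribution.MainEstimateOn μ Ω X₀ X ε` ("(3.4) holds
  with gain `ε` on the compact subsets of `Ω`") and
  `Literature.Analysis.Distribution.APrioriEstimateOn μ Ω X₀ X c ε` ("(3.5) holds with gain `ε`
  on the compact subsets of `Ω`", the hypothesis of Propositions 3.1/3.2 as printed: "Assume
  that (3.5) is valid for compact subsets `K` of `Ω`"), with all data explicit, and the
  elementary algebra `est35_of_est33_of_est34` combining (3.3) and (3.4) into (3.5).
* API for the dual norm: boundedness of the defining family for `f ∈ L²` (Cauchy–Schwarz,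
  `abs_integral_mul_le_l2Norm_mul`), the pairing inequality `|∫ f w| ≤ |||f|||' |||w|||` and the
  dual characterisation `tripleDualNorm_le_of_forall_le`.

No named fact is introduced here. The two deep inputs of Theorem 1.1 — the main estimate
(3.4) (Theorem 5.1 with Theorem 4.3: §4 Hölder norms along the flows `e^{tX}`,
Campbell–Hausdorff; §5 smoothing along vector fields) and Proposition 3.2 (regularisation
`(1 - δ²Δ)⁻¹`, pseudo-differential cut-offs, the Sobolev scale on `𝓓'(Ω)`) — are phrased with
these predicates and enter the PROVED conditional assembly of `Hormander1967_thm11`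
(`HormanderTheoremAssembly.lean`) as explicit hypotheses; the elementary estimate (3.3) is
PROVED (`HormanderEnergyEstimate.lean`, integration by parts).

## Design choices and wording risks

* All norms are real numbers attached to plain functions `E → ℝ`; the estimates quantify over
  smooth `v` with `tsupport v ⊆ K`, `K ⊆ Ω` compact (= `v ∈ C_0^∞(K)`).
* `‖·‖` is the `L²` norm of the reference Haar measure `μ` of `Hormander1967_thm11` (Lebesgue
  measure `dx` up to a constant factor). `l2Norm μ f = (∫ f² dμ)^{1/2}` is written with the
  Bochner integral because that is the form produced by the integration-by-parts identities
  discharging (3.3) (`FieldIntegrationByParts.lean`: `∫ (Xv)² dμ`, `∫ c v² dμ`); it equals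
  Mathlib's `(eLpNorm f 2 μ).toReal` for `f ∈ L²(μ)` (`l2Norm_eq_toReal_eLpNorm`), with the same
  junk value `0` otherwise.
* `‖v‖_(s)` REUSES the tree's Fourier-side norm `Function.eSobolevNorm s`
  (`(∫ (1 + ‖ξ‖²)^s ‖𝓕f(ξ)‖² dξ)^{1/2}`, Mathlib's `L²` Fourier transform, equal to Mathlib's
  Bessel-potential `MemSobolev` norm for `p = 2`, see `FourierSobolevNorm.lean`), applied to
  the complexification of `v ∘ toEuclidean⁻¹` on `EuclideanSpace ℝ (Fin n)` and made real by
  `toReal` (junk `0` if `v ∘ toEuclidean⁻¹ ∉ L²`, never the case for smooth compactly supported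
  `v`). Compared with Hörmander's `(2π)^{-n}∫|v̂|²(1+|ξ|²)^s dξ` this differs by the change of
  variables `ξ ↦ 2πξ` (Mathlib's phase `-2πi⟨x, ξ⟩`) and of linear coordinates, i.e. it is an
  EQUIVALENT norm. Since the constants `C` of (3.3)–(3.5) are existential (and depend on `K`),
  every statement below is invariant under such equivalences; only `ε` is shared, and it is
  invariant too. Consumers proving Prop. 3.2 can thus work directly on Mathlib's Sobolev
  scale after transporting along `toEuclidean`.
* The dual norm: the printed definition (p. 152) takes the supremum over `v ∈ C_0^∞`; we read
  the OCR-damaged domain as `C_0^∞(Ω)` (all test functions on `Ω`), the reading under which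
  remark 4° of p. 154 ("`|||χ₂(1-δ²Δ)⁻¹χ₁f|||' ≤ C|||f|||'` follows from the first [inequality,
  for `u ∈ C_0^∞(Ω)`]" by duality) and Prop. 3.1 (`|||Pv|||' < ∞` for `v ∈ L² ∩ 𝓔'(Ω)`) make
  sense. It is a real supremum `⨆`; the quotient is `0` at `w = 0`, and the family is bounded
  (by `‖f‖_{L²(μ)}`, Cauchy–Schwarz and `‖w‖ ≤ |||w|||`) whenever `f ∈ L²(μ)`, in particular for
  the smooth compactly supported `f = X₀v, Pv` of the statements; for `f ∉ L²` the value may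
  be the junk `0` of `iSup`.
* `HasSpanningBrackets` renders the hypothesis "`T^s(Ω) = T(Ω)` for some `s > 0`" of
  Theorems 4.3/5.1: finitely many iterated brackets span at every point of `Ω` (then they
  generate `T(Ω)` as a `C^∞(Ω)`-module, by Cramer's rule locally and a partition of unity,
  and `s = min s(I) > 0`). `MainEstimateOn`/`APrioriEstimateOn` fix ONE gain `ε` for all
  compact `K ⊆ Ω` with `C = C(K)`, as printed ((3.4): "for some `ε > 0` … `v ∈ C_0^∞(K)`";
  Prop. 3.2: "(3.5) is valid for compact subsets `K` of `Ω`").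
* (3.3) and (3.5) carry the zeroth-order term `c` (through `P`) but (3.4) does not involve `c`,
  as printed.

## References

* L. Hörmander, *Hypoelliptic second order differential equations*, Acta Math. 119 (1967)
  147–171: §3 (pp. 152–156: (3.1)–(3.5), Props. 3.1–3.2), Thm 4.3 (p. 159), Thm 5.1 (p. 167).
-/

noncomputable section

open MeasureTheory TopologicalSpace Set Function Distributions Filter FourierTransform
open scoped ContDiff Topology

namespace Literature.Analysis.Distribution

variable {E : Type*} [NormedAddCommGroup E] [NormedSpace ℝ E]

/-! ### The norms of §3 -/

section Norms

variable [MeasurableSpace E]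

/-- The `L²` norm `‖f‖ = (∫ f² dμ)^{1/2}` of a real function (Hörmander 1967, p. 152: "the
notation `‖ ‖` for the `L²` norm"); junk value `0` (from the Bochner integral) if `f²` is not
integrable. [cite: Hormander1967, p. 152] -/
def l2Norm (μ : Measure E) (f : E → ℝ) : ℝ :=
  Real.sqrt (∫ x, f x ^ 2 ∂μ)

omit [NormedAddCommGroup E] [NormedSpace ℝ E] in
/-- `‖f‖ ≥ 0`. [folklore] -/
theorem l2Norm_nonneg (μ : Measure E) (f : E → ℝ) : 0 ≤ l2Norm μ f := Real.sqrt_nonneg _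

omit [NormedAddCommGroup E] [NormedSpace ℝ E] in
/-- For `f ∈ L²(μ)` the Bochner-integral `L²` norm is Mathlib's `eLpNorm f 2 μ` made real.
[folklore] -/
theorem l2Norm_eq_toReal_eLpNorm {μ : Measure E} {f : E → ℝ} (hf : MemLp f 2 μ) :
    l2Norm μ f = (eLpNorm f 2 μ).toReal := by
  rw [hf.eLpNorm_eq_integral_rpow_norm two_ne_zero ENNReal.ofNat_ne_top,
    ENNReal.toReal_ofReal (by positivity), l2Norm, Real.sqrt_eq_rpow, ENNReal.toReal_ofNat,
    one_div]
  congr 1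
  refine integral_congr_ae (Eventually.of_forall fun x => ?_)
  simp only [Real.rpow_two, Real.norm_eq_abs, sq_abs]

variable {ι : Type*} [Fintype ι]

/-- Hörmander's norm `|||v|||`, `|||v|||² = ∑_j ‖X_j v‖² + ‖v‖²` (p. 152, the `X_j`,
`j = 1, …, r`, being the vector fields of the squares in (1.6), `X_j v = Dv · X_j`).
[cite: Hormander1967, p. 152] -/
def tripleNorm (μ : Measure E) (X : ι → E → E) (v : E → ℝ) : ℝ :=
  Real.sqrt ((∑ j, l2Norm μ (fieldDeriv (X j) v) ^ 2) + l2Norm μ v ^ 2)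

/-- `|||v||| ≥ 0`. [folklore] -/
theorem tripleNorm_nonneg (μ : Measure E) (X : ι → E → E) (v : E → ℝ) :
    0 ≤ tripleNorm μ X v := Real.sqrt_nonneg _

/-- `|||v|||² = ∑_j ‖X_j v‖² + ‖v‖²`. [cite: Hormander1967, p. 152] -/
theorem tripleNorm_sq (μ : Measure E) (X : ι → E → E) (v : E → ℝ) :
    tripleNorm μ X v ^ 2 = (∑ j, l2Norm μ (fieldDeriv (X j) v) ^ 2) + l2Norm μ v ^ 2 :=
  Real.sq_sqrt (add_nonneg (Finset.sum_nonneg fun _ _ => sq_nonneg _) (sq_nonneg _))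

/-- `‖v‖ ≤ |||v|||`. [cite: Hormander1967, p. 152] -/
theorem l2Norm_le_tripleNorm (μ : Measure E) (X : ι → E → E) (v : E → ℝ) :
    l2Norm μ v ≤ tripleNorm μ X v := by
  rw [← pow_le_pow_iff_left₀ (l2Norm_nonneg μ v) (tripleNorm_nonneg μ X v) two_ne_zero,
    tripleNorm_sq]
  exact le_add_of_nonneg_left (Finset.sum_nonneg fun _ _ => sq_nonneg _)

/-- Hörmander's dual norm `|||f|||' = sup |∫ f w dμ| / |||w|||`, the supremum extending over the
test functions `w ∈ 𝓓(Ω)` (p. 152; `w = 0` contributes `0`). A real supremum: meaningful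
(the family is bounded, by `‖f‖_{L²}`) for `f ∈ L²(μ)`, junk `0` of `iSup` otherwise.
[cite: Hormander1967, p. 152] -/
def tripleDualNorm (μ : Measure E) (Ω : Opens E) (X : ι → E → E) (f : E → ℝ) : ℝ :=
  ⨆ w : 𝓓(Ω, ℝ), |∫ x, f x * w x ∂μ| / tripleNorm μ X w

/-- `|||f|||' ≥ 0`. [folklore] -/
theorem tripleDualNorm_nonneg (μ : Measure E) (Ω : Opens E) (X : ι → E → E) (f : E → ℝ) :
    0 ≤ tripleDualNorm μ Ω X f :=
  Real.iSup_nonneg fun w => div_nonneg (abs_nonneg _) (tripleNorm_nonneg μ X w)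

/-- `‖X_j v‖ ≤ |||v|||`. [cite: Hormander1967, p. 152] -/
theorem l2Norm_fieldDeriv_le_tripleNorm (μ : Measure E) (X : ι → E → E) (v : E → ℝ) (j : ι) :
    l2Norm μ (fieldDeriv (X j) v) ≤ tripleNorm μ X v := by
  rw [← pow_le_pow_iff_left₀ (l2Norm_nonneg μ _) (tripleNorm_nonneg μ X v) two_ne_zero,
    tripleNorm_sq]
  exact (Finset.single_le_sum (f := fun j => l2Norm μ (fieldDeriv (X j) v) ^ 2)
    (fun _ _ => sq_nonneg _) (Finset.mem_univ j)).trans (le_add_of_nonneg_right (sq_nonneg _))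

omit [NormedAddCommGroup E] [NormedSpace ℝ E] in
/-- `‖f‖² = ∫ f² dμ`. [folklore] -/
theorem l2Norm_sq (μ : Measure E) (f : E → ℝ) : l2Norm μ f ^ 2 = ∫ x, f x ^ 2 ∂μ :=
  Real.sq_sqrt (integral_nonneg fun _ => sq_nonneg _)

omit [NormedAddCommGroup E] [NormedSpace ℝ E] in
/-- **Cauchy–Schwarz**: `|∫ f g dμ| ≤ ‖f‖ ‖g‖` for `f, g ∈ L²(μ)`. [folklore] -/
theorem abs_integral_mul_le_l2Norm_mul {μ : Measure E} {f g : E → ℝ} (hf : MemLp f 2 μ)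
    (hg : MemLp g 2 μ) : |∫ x, f x * g x ∂μ| ≤ l2Norm μ f * l2Norm μ g := by
  have h2 : ENNReal.ofReal (2 : ℝ) = 2 := by simp
  have hH := integral_mul_norm_le_Lp_mul_Lq (μ := μ) Real.HolderConjugate.two_two
    (by rw [h2]; exact hf) (by rw [h2]; exact hg)
  have ef : ∫ x, ‖f x‖ ^ (2 : ℝ) ∂μ = ∫ x, f x ^ 2 ∂μ :=
    integral_congr_ae (Eventually.of_forall fun x => by
      simp only [Real.rpow_two, Real.norm_eq_abs, sq_abs])
  have eg : ∫ x, ‖g x‖ ^ (2 : ℝ) ∂μ = ∫ x, g x ^ 2 ∂μ :=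
    integral_congr_ae (Eventually.of_forall fun x => by
      simp only [Real.rpow_two, Real.norm_eq_abs, sq_abs])
  rw [ef, eg] at hH
  calc |∫ x, f x * g x ∂μ| ≤ ∫ x, |f x * g x| ∂μ := abs_integral_le_integral_abs
    _ = ∫ x, ‖f x‖ * ‖g x‖ ∂μ :=
        integral_congr_ae (Eventually.of_forall fun x => by
          simp only [abs_mul, Real.norm_eq_abs])
    _ ≤ (∫ x, f x ^ 2 ∂μ) ^ (1 / (2 : ℝ)) * (∫ x, g x ^ 2 ∂μ) ^ (1 / (2 : ℝ)) := hH
    _ = l2Norm μ f * l2Norm μ g := by rw [l2Norm, l2Norm, Real.sqrt_eq_rpow, Real.sqrt_eq_rpow]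

variable [OpensMeasurableSpace E]

/-- The family defining `|||f|||'` is bounded (by `‖f‖`) when `f ∈ L²(μ)`: `|∫ f w| ≤ ‖f‖ ‖w‖`
and `‖w‖ ≤ |||w|||`. [cite: Hormander1967, p. 152] -/
theorem bddAbove_range_tripleDualNorm {μ : Measure E} [IsFiniteMeasureOnCompacts μ]
    (Ω : Opens E) (X : ι → E → E) {f : E → ℝ} (hf : MemLp f 2 μ) :
    BddAbove (Set.range fun w : 𝓓(Ω, ℝ) => |∫ x, f x * w x ∂μ| / tripleNorm μ X w) := by
  refine ⟨l2Norm μ f, ?_⟩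
  rintro _ ⟨w, rfl⟩
  have hw : MemLp (w : E → ℝ) 2 μ := w.continuous.memLp_of_hasCompactSupport w.hasCompactSupport
  rcases eq_or_lt_of_le (tripleNorm_nonneg μ X w) with h0 | hpos
  · simp only [← h0, div_zero]
    exact l2Norm_nonneg μ f
  · rw [div_le_iff₀ hpos]
    exact (abs_integral_mul_le_l2Norm_mul hf hw).trans
      (mul_le_mul_of_nonneg_left (l2Norm_le_tripleNorm μ X w) (l2Norm_nonneg μ f))

/-- `|||f|||' ≤ ‖f‖` for `f ∈ L²(μ)`. [cite: Hormander1967, p. 152] -/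
theorem tripleDualNorm_le_l2Norm {μ : Measure E} [IsFiniteMeasureOnCompacts μ]
    (Ω : Opens E) (X : ι → E → E) {f : E → ℝ} (hf : MemLp f 2 μ) :
    tripleDualNorm μ Ω X f ≤ l2Norm μ f := by
  refine ciSup_le fun w => ?_
  have hw : MemLp (w : E → ℝ) 2 μ := w.continuous.memLp_of_hasCompactSupport w.hasCompactSupport
  rcases eq_or_lt_of_le (tripleNorm_nonneg μ X w) with h0 | hpos
  · simp only [← h0, div_zero]
    exact l2Norm_nonneg μ f
  · rw [div_le_iff₀ hpos]
    exact (abs_integral_mul_le_l2Norm_mul hf hw).trans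
      (mul_le_mul_of_nonneg_left (l2Norm_le_tripleNorm μ X w) (l2Norm_nonneg μ f))

omit [OpensMeasurableSpace E] in
/-- The dual characterisation: if `|∫ f w| ≤ M |||w|||` for all test functions `w` on `Ω`
(`M ≥ 0`), then `|||f|||' ≤ M`. [folklore] -/
theorem tripleDualNorm_le_of_forall_le {μ : Measure E} (Ω : Opens E) (X : ι → E → E)
    {f : E → ℝ} {M : ℝ} (hM : 0 ≤ M)
    (h : ∀ w : 𝓓(Ω, ℝ), |∫ x, f x * w x ∂μ| ≤ M * tripleNorm μ X w) :
    tripleDualNorm μ Ω X f ≤ M := by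
  refine ciSup_le fun w => ?_
  rcases eq_or_lt_of_le (tripleNorm_nonneg μ X w) with h0 | hpos
  · simp only [← h0, div_zero]
    exact hM
  · rw [div_le_iff₀ hpos]
    exact h w

omit [NormedSpace ℝ E] in
/-- A continuous compactly supported `w` with `‖w‖ = 0` vanishes identically, when the measure
is positive on nonempty open sets. [folklore] -/
theorem eq_zero_of_l2Norm_eq_zero {μ : Measure E} [IsFiniteMeasureOnCompacts μ]
    [μ.IsOpenPosMeasure] {w : E → ℝ}
    (hw : Continuous w) (hwc : HasCompactSupport w) (h0 : l2Norm μ w = 0) (x : E) : w x = 0 := by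
  by_contra hx
  have hsq : HasCompactSupport fun y => w y ^ 2 := by
    have : (fun y => w y ^ 2) = w * w := by ext y; simp [sq]
    rw [this]; exact hwc.mul_right
  have hpos : 0 < ∫ y, w y ^ 2 ∂μ :=
    (hw.pow 2).integral_pos_of_hasCompactSupport_nonneg_nonzero hsq (fun y => sq_nonneg (w y))
      (pow_ne_zero 2 hx)
  have hle : ∫ y, w y ^ 2 ∂μ ≤ 0 := Real.sqrt_eq_zero'.1 h0
  linarith

/-- **The pairing inequality** `|∫ f w dμ| ≤ |||f|||' · |||w|||` for `f ∈ L²(μ)` and a test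
function `w` on `Ω` (definition of the dual norm, p. 152: "`-Re ∫ v̄Pv ≤ |||v||| |||Pv|||'`").
[cite: Hormander1967, p. 152] -/
theorem abs_integral_mul_le_tripleDualNorm_mul {μ : Measure E} [IsFiniteMeasureOnCompacts μ]
    [μ.IsOpenPosMeasure] (Ω : Opens E) (X : ι → E → E) {f : E → ℝ} (hf : MemLp f 2 μ)
    (w : 𝓓(Ω, ℝ)) :
    |∫ x, f x * w x ∂μ| ≤ tripleDualNorm μ Ω X f * tripleNorm μ X w := by
  rcases eq_or_lt_of_le (tripleNorm_nonneg μ X w) with h0 | hpos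
  · have hl : l2Norm μ w = 0 :=
      le_antisymm (by rw [h0]; exact l2Norm_le_tripleNorm μ X w) (l2Norm_nonneg μ w)
    have hw0 : ∀ x, w x = 0 := eq_zero_of_l2Norm_eq_zero w.continuous w.hasCompactSupport hl
    simp [hw0, ← h0]
  · rw [← div_le_iff₀ hpos]
    exact le_ciSup (bddAbove_range_tripleDualNorm Ω X hf) w

end Norms

section Sobolev

variable [FiniteDimensional ℝ E]

/-- The Sobolev `s`-norm `‖v‖_(s)` of a function `v` (Hörmander 1967, p. 153:
`‖v‖_(s)² = (2π)^{-n} ∫ |v̂(ξ)|² (1 + |ξ|²)^s dξ`), here the tree's Fourier-side `H^s` norm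
`Function.eSobolevNorm s` (`(∫ (1 + ‖ξ‖²)^s ‖𝓕f(ξ)‖² dξ)^{1/2}` with Mathlib's `L²` Fourier
transform, phase `-2πi⟨x,ξ⟩`) of the complexified function `v ∘ toEuclidean⁻¹` on
`EuclideanSpace ℝ (Fin n)`, `n = dim E`, made real by `toReal` — an equivalent norm (change of
variables `ξ ↦ 2πξ`, linear change of coordinates). Junk value `0` if
`v ∘ toEuclidean⁻¹ ∉ L²` (never for smooth compactly supported `v`).
[cite: Hormander1967, p. 153] -/
def sobolevNorm (s : ℝ) (v : E → ℝ) : ℝ :=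
  (Function.eSobolevNorm s fun y : EuclideanSpace ℝ (Fin (Module.finrank ℝ E)) =>
    ((v (toEuclidean.symm y) : ℝ) : ℂ)).toReal

/-- `‖v‖_(s) ≥ 0`. [folklore] -/
theorem sobolevNorm_nonneg (s : ℝ) (v : E → ℝ) : 0 ≤ sobolevNorm s v := ENNReal.toReal_nonneg

end Sobolev

/-! ### Finitely many brackets spanning everywhere (the hypothesis of Theorems 4.3 and 5.1) -/

section Brackets

/-- The hypothesis "`T^s(Ω) = T(Ω)` for some `s > 0`" of Hörmander's Theorems 4.3 and 5.1 in
pointwise form: there are finitely many iterated brackets `V₁, …, V_m` of the family `X`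
(`IsIteratedLieBracket`) whose values span the whole space at every point of `s`.
[cite: Hormander1967, Thm 4.3] -/
def HasSpanningBrackets {κ : Type*} (X : κ → E → E) (s : Set E) : Prop :=
  ∃ (m : ℕ) (V : Fin m → E → E), (∀ i, IsIteratedLieBracket X (V i)) ∧
    ∀ x ∈ s, Submodule.span ℝ (Set.range fun i => V i x) = ⊤

/-- `HasSpanningBrackets` is monotone in the set. [folklore] -/
theorem HasSpanningBrackets.mono {κ : Type*} {X : κ → E → E} {s t : Set E}
    (h : HasSpanningBrackets X s) (hts : t ⊆ s) : HasSpanningBrackets X t := by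
  obtain ⟨m, V, hV, hsp⟩ := h
  exact ⟨m, V, hV, fun x hx => hsp x (hts hx)⟩

/-- Finitely many brackets spanning everywhere imply the pointwise bracket condition.
[folklore] -/
theorem HasSpanningBrackets.isBracketGenerating {κ : Type*} {X : κ → E → E} {s : Set E}
    (h : HasSpanningBrackets X s) : IsBracketGenerating X s := by
  obtain ⟨m, V, hV, hsp⟩ := h
  intro x hx
  rw [eq_top_iff, ← hsp x hx]
  refine Submodule.span_mono ?_
  rintro v ⟨i, rfl⟩
  exact ⟨V i, hV i, rfl⟩

/-- Iterated brackets of smooth vector fields are smooth. [folklore] -/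
theorem IsIteratedLieBracket.contDiff {κ : Type*} {X : κ → E → E}
    (hX : ∀ i, ContDiff ℝ ∞ (X i)) {V : E → E} (hV : IsIteratedLieBracket X V) :
    ContDiff ℝ ∞ V := by
  induction hV with
  | of i => exact hX i
  | lieBracket i _ ih => exact (hX i).lieBracket_vectorField ih (by exact_mod_cast le_top)

variable [FiniteDimensional ℝ E]

/-- **The pointwise bracket condition of Theorem 1.1 holds uniformly near each point**: if the
iterated brackets of a family of smooth vector fields span at `x`, then finitely many of them
span at every point of a neighbourhood of `x` (choose `n = dim E` brackets independent at `x`;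
linear independence is an open condition). This is the (implicit) step from the hypothesis of
Theorem 1.1 to the hypothesis `T^s(Ω') = T(Ω')` of Theorems 4.3/5.1 on small open sets `Ω'`.
[folklore] -/
theorem IsBracketGenerating.exists_hasSpanningBrackets_nhds {κ : Type*} {X : κ → E → E}
    {Ω : Set E} (hX : ∀ i, ContDiff ℝ ∞ (X i)) (h : IsBracketGenerating X Ω) {x : E}
    (hx : x ∈ Ω) : ∃ W : Set E, IsOpen W ∧ x ∈ W ∧ HasSpanningBrackets X W := by
  classical
  set S : Set E := {v : E | ∃ V : E → E, IsIteratedLieBracket X V ∧ V x = v} with hS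
  have hspan : Submodule.span ℝ S = ⊤ := h x hx
  obtain ⟨B, hBS, hBspan, hBli⟩ := exists_linearIndependent ℝ S
  have hBfin : B.Finite := hBli.setFinite
  haveI : Fintype B := hBfin.fintype
  -- `B` is a basis, so it has `dim E` elements
  have hBtop : ⊤ ≤ Submodule.span ℝ (Set.range ((↑) : B → E)) := by
    rw [Subtype.range_coe, hBspan, hspan]
  have hcard : Fintype.card B = Module.finrank ℝ E :=
    (Module.finrank_eq_card_basis (Module.Basis.mk hBli hBtop)).symm
  -- brackets realising the basis vectors at `x`
  have hchoice : ∀ b : B, ∃ V : E → E, IsIteratedLieBracket X V ∧ V x = b := fun b => hBS b.2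
  choose V hV hVx using hchoice
  set m := Fintype.card B
  let e : B ≃ Fin m := Fintype.equivFin B
  let V' : Fin m → E → E := fun i => V (e.symm i)
  have hV' : ∀ i, IsIteratedLieBracket X (V' i) := fun i => hV _
  -- independence at `x`, hence near `x`
  have hli : LinearIndependent ℝ fun i => V' i x := by
    have : (fun i => V' i x) = ((↑) : B → E) ∘ e.symm := funext fun i => hVx _
    rw [this]
    exact hBli.comp _ e.symm.injective
  have hcont : Continuous fun y : E => fun i : Fin m => V' i y :=
    continuous_pi fun i => ((hV' i).contDiff hX).continuous
  set W : Set E := (fun y : E => fun i : Fin m => V' i y) ⁻¹' {f | LinearIndependent ℝ f}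
  refine ⟨W, isOpen_setOf_linearIndependent.preimage hcont, hli, m, V', hV', fun y hy => ?_⟩
  exact LinearIndependent.span_eq_top_of_card_eq_finrank' hy (by rw [Fintype.card_fin, hcard])

end Brackets

/-! ### The a priori estimates (3.4) and (3.5) as predicates -/

section Estimates

variable [MeasurableSpace E] [FiniteDimensional ℝ E] {ι : Type*} [Fintype ι]

/-- **Hörmander's main estimate (3.4) with gain `ε`, on the compact subsets of `Ω`** (p. 153:
"for some `ε > 0` (3.4) `‖v‖_(ε) ≤ C(|||v||| + |||X₀v|||')`, `v ∈ C_0^∞(K)`", `C = C(K)`; it is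
the content of Theorem 5.1 with Theorem 4.3, under the hypothesis `T^s(Ω) = T(Ω)`, i.e.
`HasSpanningBrackets` on `Ω`): for every compact `K ⊆ Ω` there is `C` with
`‖v‖_(ε) ≤ C(|||v||| + |||X₀v|||')` for all smooth `v` supported in `K`. All data explicit;
the zeroth-order term `c` plays no role. [cite: Hormander1967, eq. (3.4)] -/
def MainEstimateOn (μ : Measure E) (Ω : Opens E) (X₀ : E → E) (X : ι → E → E) (ε : ℝ) :
    Prop :=
  ∀ K : Set E, IsCompact K → K ⊆ (Ω : Set E) → ∃ C : ℝ, ∀ v : E → ℝ,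
    ContDiff ℝ ∞ v → tsupport v ⊆ K →
      sobolevNorm ε v ≤ C * (tripleNorm μ X v + tripleDualNorm μ Ω X (fieldDeriv X₀ v))

/-- **Hörmander's a priori estimate (3.5) with gain `ε`, on the compact subsets of `Ω`**
(p. 153: "(3.5) `‖v‖_(ε) ≤ C(‖v‖ + |||Pv|||')`, `v ∈ C_0^∞(K)`"; Props. 3.1/3.2: "Assume that
(3.5) is valid for compact subsets `K` of `Ω`"), for `P = ∑_j X_j² + X₀ + c` (`hormanderOp`):
for every compact `K ⊆ Ω` there is `C` with `‖v‖_(ε) ≤ C(‖v‖ + |||Pv|||')` for all smooth `v`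
supported in `K`. [cite: Hormander1967, eq. (3.5)] -/
def APrioriEstimateOn (μ : Measure E) (Ω : Opens E) (X₀ : E → E) (X : ι → E → E) (c : E → ℝ)
    (ε : ℝ) : Prop :=
  ∀ K : Set E, IsCompact K → K ⊆ (Ω : Set E) → ∃ C : ℝ, ∀ v : E → ℝ,
    ContDiff ℝ ∞ v → tsupport v ⊆ K →
      sobolevNorm ε v ≤ C * (l2Norm μ v + tripleDualNorm μ Ω X (hormanderOp X₀ X c v))

end Estimates

/-! ### Combining (3.3) and (3.4) into (3.5) -/

/-- **(3.3) and (3.4) give (3.5)** (p. 153: "Combining this with (3.3) we obtain (3.5)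
`‖v‖_(ε) ≤ C(‖v‖ + |||Pv|||')`"): the elementary inequality behind it, for nonnegative reals
`S = ‖v‖_(ε)`, `A = |||v|||`, `B = |||X₀v|||'`, `L = ‖v‖`, `D = |||Pv|||'`.
[cite: Hormander1967, eq. (3.5)] -/
theorem est35_of_est33_of_est34 {S A B L D C₁ C₂ : ℝ} (hA : 0 ≤ A) (hB : 0 ≤ B) (hL : 0 ≤ L)
    (hD : 0 ≤ D) (h34 : S ≤ C₁ * (A + B)) (h33 : A ^ 2 + B ^ 2 ≤ C₂ * (L ^ 2 + D ^ 2)) :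
    S ≤ max C₁ 0 * Real.sqrt (2 * max C₂ 0) * (L + D) := by
  have hC₁ : C₁ * (A + B) ≤ max C₁ 0 * (A + B) :=
    mul_le_mul_of_nonneg_right (le_max_left _ _) (add_nonneg hA hB)
  have h33' : A ^ 2 + B ^ 2 ≤ max C₂ 0 * (L ^ 2 + D ^ 2) :=
    h33.trans (mul_le_mul_of_nonneg_right (le_max_left _ _) (by positivity))
  have hAB : A + B ≤ Real.sqrt (2 * max C₂ 0) * (L + D) := by
    rw [← pow_le_pow_iff_left₀ (add_nonneg hA hB) (by positivity) two_ne_zero, mul_pow,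
      Real.sq_sqrt (by positivity)]
    nlinarith [sq_nonneg (A - B), mul_nonneg hL hD, le_max_right C₂ 0]
  calc S ≤ max C₁ 0 * (A + B) := h34.trans hC₁
    _ ≤ max C₁ 0 * (Real.sqrt (2 * max C₂ 0) * (L + D)) :=
        mul_le_mul_of_nonneg_left hAB (le_max_right _ _)
    _ = max C₁ 0 * Real.sqrt (2 * max C₂ 0) * (L + D) := by ring

end Literature.Analysis.Distribution
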